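import Mathlib
import Summits.SmoothPoincare4.SmoothPoincare4.Theorems.SoloBlindGenericState

/-!
# Algebraic skeleton of the O-position theorem (solo-blind s7)

Exact identities behind `paper/cs-gompf-classes.md` §4d (solo seat `solo-SmoothPoincare4-blind`):
the linearisation identities of the norm-gap lemma (the `d = 1` systole law), the binary norm form
`Ψ_t(u,v) = N(u + v θ)` with its fibre-shift and TWIST laws, the fibre-shift laws of the ternary norm form and
of the state congruence, and the three elementary integer steps (primitivity, index cancellation, congruence pin)
that close the proof of THEOREM O.

*Setting* (as in `SoloBlindGenericState`): `fPoly t r = r³ - t r² + (t-1) r - 1`, `θ = θ_t` a root, states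
`(c, d)` with `d ∣ f_t(c)`, `normForm A B C t = Res(f_t, A x² + B x + C)`.

*What is certified here* (pure algebra over a commutative ring `R`, or over `ℤ`):
1. `psiForm_eq_normForm`: `Ψ_t(u,v) = normForm 0 v u t`, so `Ψ_t(u,v) = u³ + t u² v + (t-1) u v² + v³`
   is the norm of the LINEAR element `u + v θ`; `psiForm_fibre_shift`:
   `Ψ_{t'} - Ψ_t = (t' - t)·uv(u+v)`; `psiForm_twist`: at an O-POSITION `t' = t + j·(d·Ψ_t(u,v))` one has
   `Ψ_{t'}(u,v) = Ψ_t(u,v) · (1 + j d · uv(u+v))` — the second factor is the TWIST INDEX `q̂`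
   (`q = |q̂| ≡ ±1 (mod d)`, `q ≥ 2d - 1`), the index of `b'·J_{t'}` in `J'_{t'}`; `twist_coprime`.
2. `normForm_fibre_shift`: `N_{t'}(G) - N_t(G) = (t' - t)·(A·C·(A+B+C)·(t + t') + E₁(A,B,C))`;
   `fPoly_fibre_shift` / `fPoly_dvd_of_fibre_shift`: a state at the fibre `t` is a state at every fibre
   `t' ≡ t (mod d)`.
3. NORM-GAP LINEARISATIONS.  Write `H = A x² + B x + C`, `S = B + A (t-1)`, `P = A + B + C`, `Q = C - A (t-2)`,
   `R = C + (t-1) S`.  On a root `x` of `f_t` (where `x`, `x - 1`, `x - (t-1)` are units, `root_unit`):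
   `S = 0 ⇒ (x-1)·H = A + C (x-1)` (`ngl_lin_S`); `S + A = 0 ⇒ x·H = A + (C - A(t-1)) x` (`ngl_lin_SA`);
   `P = A ⇒ (x-1)·H = x·((A - S) + S x)` (`ngl_lin_PA`); `Q + A = 0 ⇒ x·H = (x-1)·(-A + (A+S) x)` (`ngl_lin_QA`);
   `R = 0 ⇒ H = (x - (t-1))(A x + C')` and `x(x-1)·H = A x + C'` (`ngl_lin_R`).  Together with the trivial case
   `A = 0` these say: every DEGENERATE element (one of the six linear forms of the G1 analysis vanishing) is a
   unit times a LINEAR element — the mechanism by which a principal ideal of norm `< 0.059 t²` is generated by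
   some `e + e' θ` (norm-gap lemma of §4d; the inequality part lives in the paper, not here).
4. THEOREM O, integer steps: `prim_of_cyclic` (a common divisor `g` of the coefficients `(a, a')` with
   `g ∣ v`, `g ∣ u - v s` and `u, v` coprime is a unit — primitivity of the linear generator forced by
   cyclicity of `Q ∋ θ' - s`); `twist_dvd_cancel` (from `Ψ·q̂ ∣ d·Ψ·w`, `Ψ ≠ 0`, `q̂` coprime to `d`:
   `q̂ ∣ w` — the evaluation of `(a + a'θ') J' ⊆ b' O` at the root of `b'` modulo `Ψ_{t'}`);
   `pin_of_small` (`q ∣ m` and `|m| < q` force `m = 0` — the final pin `a v - a' u = 0`).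
Nothing here depends on numerics; the inequalities of §4d (G1 box, window analysis) are NOT claimed here.
-/

namespace Summit.SmoothPoincare4.SmoothPoincare4.Theorems

section Forms
variable {R : Type*} [CommRing R]

/-- Binary norm form: `Ψ_t(u,v) = N_{ℚ(θ_t)/ℚ}(u + v θ_t)`. -/
def psiForm (t u v : R) : R := u ^ 3 + t * u ^ 2 * v + (t - 1) * u * v ^ 2 + v ^ 3

/-- `Ψ_t(u,v)` is the ternary norm form of the linear element `0·x² + v·x + u`. -/
theorem psiForm_eq_normForm (t u v : R) : psiForm t u v = normForm 0 v u t := by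
  unfold psiForm normForm normE₁ normE₀; ring

/-- Fibre shift of the binary norm form. -/
theorem psiForm_fibre_shift (t t' u v : R) :
    psiForm t' u v - psiForm t u v = (t' - t) * (u * v * (u + v)) := by
  unfold psiForm; ring

/-- TWIST INDEX at an O-position: if `t' = t + j · (d · Ψ_t(u,v))` then
`Ψ_{t'}(u,v) = Ψ_t(u,v) · (1 + j · d · uv(u+v))`. -/
theorem psiForm_twist (t u v j d : R) :
    psiForm (t + j * (d * psiForm t u v)) u v = psiForm t u v * (1 + j * d * (u * v * (u + v))) := by
  unfold psiForm; ring

/-- Fibre shift of the ternary norm form `N_t(A θ² + B θ + C)`. -/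
theorem normForm_fibre_shift (A B C t t' : R) :
    normForm A B C t' - normForm A B C t =
      (t' - t) * (A * C * (A + B + C) * (t + t') + normE₁ A B C) := by
  unfold normForm; ring

/-- Fibre shift of the state congruence polynomial. -/
theorem fPoly_fibre_shift (t t' c : R) : fPoly t' c - fPoly t c = -((t' - t) * (c ^ 2 - c)) := by
  unfold fPoly; ring

/-! ### Norm-gap linearisation identities (`x` a root of `f_t`) -/

/-- Case `S = 0`, i.e. `B = -A (t-1)`: `(x - 1) · H = A + C (x - 1)`. -/
theorem ngl_lin_S (t x A C : R) (hf : fPoly t x = 0) :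
    (x - 1) * (A * (x * (x - (t - 1))) + C) = A + C * (x - 1) := by
  unfold fPoly at hf; linear_combination A * hf

/-- Case `S + A = 0`, i.e. `B = -A t`: `x · H = A + (C - A (t-1)) x`. -/
theorem ngl_lin_SA (t x A C : R) (hf : fPoly t x = 0) :
    x * (A * (x ^ 2 - t * x) + C) = A + (C - A * (t - 1)) * x := by
  unfold fPoly at hf; linear_combination A * hf

/-- Case `P = A`, i.e. `C = -B`, written with `S = B + A (t-1)`: `(x - 1) · H = x · ((A - S) + S x)`. -/
theorem ngl_lin_PA (t x A S : R) (hf : fPoly t x = 0) :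
    (x - 1) * (A * (x ^ 2 - (t - 1) * x + 1) + S * x) = x * ((A - S) + S * x) := by
  unfold fPoly at hf; linear_combination A * hf

/-- Case `Q + A = 0`, i.e. `C = A (t-3) - S`: `x · H = (x - 1) · (-A + (A + S) x)`. -/
theorem ngl_lin_QA (t x A S : R) (hf : fPoly t x = 0) :
    x * (A * (x ^ 2 - (t - 1) * x + (t - 3)) + S * (x - 1)) = (x - 1) * (-A + (A + S) * x) := by
  unfold fPoly at hf; linear_combination A * hf

/-- Case `R = 0`: `H = (x - (t-1)) (A x + C')` and `x (x-1) (x - (t-1)) = 1`, so `x (x-1) · H = A x + C'`. -/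
theorem ngl_lin_R (t x A C' : R) (hf : fPoly t x = 0) :
    (x * (x - 1)) * ((x - (t - 1)) * (A * x + C')) = A * x + C' := by
  unfold fPoly at hf; linear_combination (A * x + C') * hf

end Forms

/-! ### Integer steps of Theorem O -/

/-- A state at the fibre `t` is a state at every fibre `t' ≡ t (mod d)`. -/
theorem fPoly_dvd_of_fibre_shift (d t t' c : ℤ) (h : d ∣ fPoly t c) (ht : d ∣ t' - t) :
    d ∣ fPoly t' c := by
  have e : fPoly t' c = fPoly t c + -((t' - t) * (c ^ 2 - c)) := by
    have := fPoly_fibre_shift t t' c; linarith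
  rw [e]
  exact dvd_add h (Dvd.dvd.neg_right (Dvd.dvd.mul_right ht _))

/-- Primitivity from cyclicity: if `g` divides `v` and `u - v s` (the coefficients of `b' (θ' - s)` modulo
the leading one) and `u, v` are coprime, then `g` is a unit. -/
theorem prim_of_cyclic (g u v s : ℤ) (hv : g ∣ v) (h2 : g ∣ u - v * s) (hcop : IsCoprime u v) :
    IsUnit g := by
  have hu : g ∣ u := by
    have e : u = (u - v * s) + s * v := by ring
    rw [e]; exact dvd_add h2 (Dvd.dvd.mul_left hv _)
  exact hcop.isUnit_of_dvd' hu hv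

/-- Index cancellation: from `Ψ · q̂ ∣ d · Ψ · w` with `Ψ ≠ 0` and `q̂` coprime to `d`, `q̂ ∣ w`. -/
theorem twist_dvd_cancel (Ψ q d w : ℤ) (hΨ : Ψ ≠ 0) (hcop : IsCoprime q d)
    (h : Ψ * q ∣ d * Ψ * w) : q ∣ w := by
  have h1 : q ∣ d * w := by
    have e : d * Ψ * w = Ψ * (d * w) := by ring
    rw [e] at h
    exact (mul_dvd_mul_iff_left hΨ).mp h
  exact hcop.dvd_of_dvd_mul_left h1

/-- The twist index is coprime to `d`: `q̂ = 1 + j d · m`. -/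
theorem twist_coprime (j d m : ℤ) : IsCoprime (1 + j * d * m) d := by
  refine ⟨1, -(j * m), ?_⟩; ring

/-- Congruence pin: `q ∣ m` and `|m| < q` force `m = 0`. -/
theorem pin_of_small (q m : ℤ) (hq : q ∣ m) (hlt : |m| < q) : m = 0 :=
  Int.eq_zero_of_abs_lt_dvd hq hlt

end Summit.SmoothPoincare4.SmoothPoincare4.Theorems
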